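import Mathlib
import HarnessLib
import Summits.KontsevichZagierPeriods.Zeta5Search.SorokinLastVariable
import Summits.KontsevichZagierPeriods.Zeta5Search.BarnesEulerIntegralCut

/-!
# ζ(5) search — Zudilin's `J_{k+1}` at complex parameters: peeling the FIRST variable (cell `pub-zeta5`, ct-1 g28)

HONEST FRAMING: systematic search; no irrationality claim unless kernel-certified.  An identity of integrals (Fubini) and a fibre
identity (Mellin–Barnes); nothing here is an irrationality result, a worthiness exponent or a denominator statement; no named fact
is discharged; NO definition is introduced (the complex-parameter integrand is written inline, g27's conventions).

Brick B6a (first half) of `HOME/ct-1/g28/VWP-BLUEPRINT-g28.md` — the corrected induction step of Zudilin math/0206177 peels the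
FIRST variable: by the FIRST recursion of (3), `Q_{k+1}(t, x') = 1 − t·Q_k(x')` (definitional for `nestedQ (t :: _)`), so with
`z := Q_k(x') ∈ (0,1)` (ALWAYS, whatever the parity of `k`) the `t = x₀` integral is the tree's Euler integral
`eulerIntegral a₀ a_0 b_0 z = ∫₀¹ t^{a_0−1}(1−t)^{b_0−a_0−1}(1−zt)^{−a₀} dt`, and Nesterenko's Lemma 2 ON THE CUT
(`BarnesEulerIntegralCut.eulerIntegral_pos_eq_barnes`, phase `e^{±iπs}`) applies:

* `cube_eq_preimage_zero`, `piFinSuccAbove_zero_symm` — `[0,1]^{k+1} ≃ [0,1] × [0,1]^k` along `x ↦ (x₀, tail x)`, inverse `Fin.cons`;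
* `integrand_cons` — `F(Fin.cons t x') = [∏_{j<k} x'_j^{a_{j+1}−1}(1−x'_j)^{b_{j+1}−a_{j+1}−1}] · eulerIntegrand a₀ a_0 b_0 (Q_k x') t`;
* **`setIntegral_succ_eq_first`** — `∫_{[0,1]^{k+1}} F = ∫_{[0,1]^k} ∏'(x') · eulerIntegral a₀ a_0 b_0 (Q_k x') dx'` (F integrable);
* **`fibre_eq_first`** — on the open cube (`k ≥ 1`): `∏'(x') · eulerIntegral a₀ a_0 b_0 (Q_k x') = Γ(b_0−a_0)/Γ(a₀) · (1/2π)∫ K(y) e^{iεπs} ·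
  [∏'(x') · Q_k(x')^{−(−s)}] dy`, `s = −t₀+iy`, `ε = ±1`, under `0 < t₀ < Re a₀`, `t₀ < Re a_0` and the CUT CONDITION
  `Re a₀ + Re a_0 < Re b_0` — the bracket is the integrand of `J_k(−s; a_{·+1} | b_{·+1})` at `x'`, exponent `Re(−s) = t₀ > 0`.

The swap of the `x'`- and `y`-integrals (Lemma 3') is the companion file `SorokinLemma3First`.  Theorems only.
-/

noncomputable section

namespace Summit.KontsevichZagierPeriods.Zeta5Search.SorokinFirstVariable

open MeasureTheory Set Filter
open scoped Real
open Literature.NumberTheory.Irrationality.Zudilin2002 (nestedQ sorokinIntegrand)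
open Literature.Analysis.SpecialFunctions.Hypergeometric (eulerIntegrand eulerIntegral)
open Summit.KontsevichZagierPeriods.Zeta5Search.SorokinIntegrandBounds

variable {t₀ : ℝ} {a₀ : ℂ} {a b : ℕ → ℂ}

/-! ### 1. Splitting off the first variable -/

/-- The closed cube `[0,1]^{k+1}` is the preimage of `[0,1] × [0,1]^k` under `x ↦ (x_0, (x_1,…,x_k))`. -/
theorem cube_eq_preimage_zero (k : ℕ) :
    (Set.pi univ fun _ : Fin (k + 1) => Icc (0 : ℝ) 1) =
      MeasurableEquiv.piFinSuccAbove (fun _ => ℝ) 0 ⁻¹'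
        (Icc (0 : ℝ) 1 ×ˢ Set.pi univ fun _ : Fin k => Icc (0 : ℝ) 1) := by
  ext x
  simp only [Set.mem_preimage, Set.mem_prod, Set.mem_univ_pi]
  rw [Fin.forall_fin_succ]
  simp [MeasurableEquiv.piFinSuccAbove_apply, Fin.tail]

/-- The inverse of that equivalence is `Fin.cons`. -/
theorem piFinSuccAbove_zero_symm (k : ℕ) (t : ℝ) (x' : Fin k → ℝ) :
    (MeasurableEquiv.piFinSuccAbove (fun _ => ℝ) (0 : Fin (k + 1))).symm (t, x') = Fin.cons t x' := by
  simp [MeasurableEquiv.piFinSuccAbove_symm_apply, Fin.consEquiv]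

/-- **Pointwise, on a fibre**: the integrand of `J_{k+1}(a₀; a | b)` at `Fin.cons t x'` is
`[∏_{j<k} x'_j^{a_{j+1}−1}(1−x'_j)^{b_{j+1}−a_{j+1}−1}] · t^{a_0−1}(1−t)^{b_0−a_0−1}(1 − Q_k(x')·t)^{−a₀}`, i.e. that product times the
tree's `eulerIntegrand a₀ a_0 b_0 (Q_k x') t` (first recursion of (3): `Q_{k+1}(t,x') = 1 − t·Q_k(x')`). -/
theorem integrand_cons (k : ℕ) (a₀ : ℂ) (a b : ℕ → ℂ) (x' : Fin k → ℝ) (t : ℝ) :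
    (∏ j : Fin (k + 1), (((Fin.cons t x' : Fin (k + 1) → ℝ) j : ℝ) : ℂ) ^ (a j - 1) *
          (1 - (((Fin.cons t x' : Fin (k + 1) → ℝ) j : ℝ) : ℂ)) ^ (b j - a j - 1)) *
        ((nestedQ (List.ofFn (Fin.cons t x' : Fin (k + 1) → ℝ)) : ℝ) : ℂ) ^ (-a₀) =
      (∏ j : Fin k, ((x' j : ℝ) : ℂ) ^ (a (j + 1) - 1) * (1 - ((x' j : ℝ) : ℂ)) ^ (b (j + 1) - a (j + 1) - 1)) *
        eulerIntegrand a₀ (a 0) (b 0) ((nestedQ (List.ofFn x') : ℝ) : ℂ) t := by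
  rw [Fin.prod_univ_succ, nestedQ_ofFn_cons, eulerIntegrand]
  simp only [Fin.cons_zero, Fin.cons_succ, Fin.val_zero, Fin.val_succ]
  push_cast
  ring

/-- **`J_{k+1}` as a `k`-fold integral of an Euler integral, first variable**: if the integrand `F` of `J_{k+1}(a₀; a | b)` is
integrable on `[0,1]^{k+1}`, then
`∫_{[0,1]^{k+1}} F = ∫_{[0,1]^k} ∏_{j<k} x'_j^{a_{j+1}−1}(1−x'_j)^{b_{j+1}−a_{j+1}−1} · eulerIntegral a₀ a_0 b_0 (Q_k x') dx'`
(transfer along `x ↦ (x_0, tail x)`, Fubini, `integrand_cons`). -/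
theorem setIntegral_succ_eq_first (k : ℕ) (a₀ : ℂ) (a b : ℕ → ℂ)
    (hF : IntegrableOn (fun x : Fin (k + 1) → ℝ =>
      (∏ j : Fin (k + 1), ((x j : ℝ) : ℂ) ^ (a j - 1) * (1 - ((x j : ℝ) : ℂ)) ^ (b j - a j - 1)) *
        ((nestedQ (List.ofFn x) : ℝ) : ℂ) ^ (-a₀)) (Set.pi univ fun _ : Fin (k + 1) => Icc (0 : ℝ) 1) volume) :
    ∫ x in Set.pi univ (fun _ : Fin (k + 1) => Icc (0 : ℝ) 1),
        (∏ j : Fin (k + 1), ((x j : ℝ) : ℂ) ^ (a j - 1) * (1 - ((x j : ℝ) : ℂ)) ^ (b j - a j - 1)) *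
          ((nestedQ (List.ofFn x) : ℝ) : ℂ) ^ (-a₀) =
      ∫ x' in Set.pi univ (fun _ : Fin k => Icc (0 : ℝ) 1),
        (∏ j : Fin k, ((x' j : ℝ) : ℂ) ^ (a (j + 1) - 1) * (1 - ((x' j : ℝ) : ℂ)) ^ (b (j + 1) - a (j + 1) - 1)) *
          eulerIntegral a₀ (a 0) (b 0) ((nestedQ (List.ofFn x') : ℝ) : ℂ) := by
  set F : (Fin (k + 1) → ℝ) → ℂ := fun x =>
    (∏ j : Fin (k + 1), ((x j : ℝ) : ℂ) ^ (a j - 1) * (1 - ((x j : ℝ) : ℂ)) ^ (b j - a j - 1)) *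
      ((nestedQ (List.ofFn x) : ℝ) : ℂ) ^ (-a₀) with hFdef
  set e := MeasurableEquiv.piFinSuccAbove (fun _ : Fin (k + 1) => ℝ) 0 with hedef
  set S : Set (ℝ × (Fin k → ℝ)) := Icc (0 : ℝ) 1 ×ˢ Set.pi univ fun _ : Fin k => Icc (0 : ℝ) 1 with hSdef
  set G : ℝ × (Fin k → ℝ) → ℂ := fun p => F (e.symm p) with hGdef
  have hmp : MeasurePreserving e volume volume := volume_preserving_piFinSuccAbove (fun _ : Fin (k + 1) => ℝ) 0
  have hcube := cube_eq_preimage_zero k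
  -- (1) transfer the integral and the integrability along `e`
  have key := hmp.setIntegral_preimage_emb e.measurableEmbedding G S
  have hGe : (fun x => G (e x)) = F := by funext x; simp [hGdef]
  rw [hGe, ← hcube] at key
  change ∫ x in Set.pi univ (fun _ : Fin (k + 1) => Icc (0 : ℝ) 1), F x = _
  rw [key]
  have hGint : Integrable G ((volume : Measure (ℝ × (Fin k → ℝ))).restrict S) := by
    have h := (hmp.restrict_preimage_emb e.measurableEmbedding S).integrable_comp_emb e.measurableEmbedding (g := G)
    rw [← hcube] at h
    have hGF : G ∘ e = F := by funext x; simp [hGdef]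
    rw [hGF] at h
    exact h.1 hF
  rw [Measure.volume_eq_prod, ← Measure.prod_restrict] at hGint ⊢
  -- (2) Fubini, integrating over `t` first
  rw [integral_prod_symm G hGint]
  refine integral_congr_ae (Eventually.of_forall fun x' => ?_)
  simp only
  have hGx : (fun t => G (t, x')) = fun t => F (Fin.cons t x') := by
    funext t; rw [hGdef]; simp only [hedef, piFinSuccAbove_zero_symm]
  rw [hGx]
  have hpt : ∀ t ∈ Icc (0 : ℝ) 1, F (Fin.cons t x') =
      (∏ j : Fin k, ((x' j : ℝ) : ℂ) ^ (a (j + 1) - 1) * (1 - ((x' j : ℝ) : ℂ)) ^ (b (j + 1) - a (j + 1) - 1)) *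
        eulerIntegrand a₀ (a 0) (b 0) ((nestedQ (List.ofFn x') : ℝ) : ℂ) t := fun t _ => by
    rw [hFdef]
    exact integrand_cons k a₀ a b x' t
  rw [setIntegral_congr_fun measurableSet_Icc hpt, integral_const_mul, eulerIntegral,
    intervalIntegral.integral_of_le zero_le_one, integral_Icc_eq_integral_Ioc]

/-! ### 2. The fibre identity (Lemma 2 on the cut) -/

/-- On the open cube, the norm of the bracket `∏'(x')·Q_k(x')^{−(−s)}` is the TYPED real `J_k`-integrand at
`(t₀; Re a_{j+1} | Re b_{j+1})` (`s = −t₀ + iy`). -/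
theorem norm_bracket {k : ℕ} (a b : ℕ → ℂ) (t₀ y : ℝ) {x : Fin k → ℝ} (hx : ∀ j, x j ∈ Ioo (0 : ℝ) 1) :
    ‖(∏ j : Fin k, ((x j : ℝ) : ℂ) ^ (a (j + 1) - 1) * (1 - ((x j : ℝ) : ℂ)) ^ (b (j + 1) - a (j + 1) - 1)) *
        ((nestedQ (List.ofFn x) : ℝ) : ℂ) ^ (-(-(-(t₀ : ℂ) + (y : ℂ) * Complex.I)))‖ =
      sorokinIntegrand k t₀ (fun n => (a (n + 1)).re) (fun n => (b (n + 1)).re) x := by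
  have h := SorokinLastVariable.norm_integrand k (-(-(t₀ : ℂ) + (y : ℂ) * Complex.I)) (fun n => a (n + 1)) (fun n => b (n + 1)) hx
  have e0 : (-(-(t₀ : ℂ) + (y : ℂ) * Complex.I)).re = t₀ := by simp
  rw [e0] at h
  exact h

/-- **The fibre identity, first variable** [Zudilin math/0206177, Lemma 2 = Nesterenko's, on the cut]: for `k ≥ 1`, `x'` in the
open cube, complex `a₀, a_j, b_j`, real `t₀` with `0 < t₀ < Re a₀`, `t₀ < Re a_0`, the CUT CONDITION `Re a₀ + Re a_0 < Re b_0`, and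
`ε = ±1`:
`∏'(x') · eulerIntegral a₀ a_0 b_0 (Q_k x') = Γ(b_0−a_0)/Γ(a₀) · (1/2π) ∫ Γ(a₀+s)Γ(a_0+s)Γ(−s)/Γ(b_0+s) · e^{iεπs} · [∏'(x')·Q_k(x')^{−(−s)}] dy`. -/
theorem fibre_eq_first {k : ℕ} (hk : 1 ≤ k) (ht₀ : 0 < t₀) (ht₀' : t₀ < a₀.re) (hta : t₀ < (a 0).re)
    (hb : a₀.re + (a 0).re < (b 0).re) {x : Fin k → ℝ} (hx : ∀ j, x j ∈ Ioo (0 : ℝ) 1) {ε : ℝ} (hε : ε = 1 ∨ ε = -1) :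
    (∏ j : Fin k, ((x j : ℝ) : ℂ) ^ (a (j + 1) - 1) * (1 - ((x j : ℝ) : ℂ)) ^ (b (j + 1) - a (j + 1) - 1)) *
        eulerIntegral a₀ (a 0) (b 0) ((nestedQ (List.ofFn x) : ℝ) : ℂ) =
      Complex.Gamma (b 0 - a 0) / Complex.Gamma a₀ *
        ((1 / (2 * π) : ℂ) * ∫ y : ℝ,
          Complex.Gamma (a₀ + (-(t₀ : ℂ) + (y : ℂ) * Complex.I)) * Complex.Gamma (a 0 + (-(t₀ : ℂ) + (y : ℂ) * Complex.I)) *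
                Complex.Gamma (-(-(t₀ : ℂ) + (y : ℂ) * Complex.I)) /
                Complex.Gamma (b 0 + (-(t₀ : ℂ) + (y : ℂ) * Complex.I)) *
              Complex.exp (ε * π * Complex.I * (-(t₀ : ℂ) + (y : ℂ) * Complex.I)) *
            ((∏ j : Fin k, ((x j : ℝ) : ℂ) ^ (a (j + 1) - 1) * (1 - ((x j : ℝ) : ℂ)) ^ (b (j + 1) - a (j + 1) - 1)) *
              ((nestedQ (List.ofFn x) : ℝ) : ℂ) ^ (-(-(-(t₀ : ℂ) + (y : ℂ) * Complex.I))))) := by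
  have hQ := nestedQ_ofFn_mem_Ioo hk hx
  rw [BarnesEulerIntegralCut.eulerIntegral_pos_eq_barnes ht₀ ht₀' hta hb hQ.1 hQ.2.le hε, ← mul_assoc,
    mul_comm _ (Complex.Gamma (b 0 - a 0) / Complex.Gamma a₀), mul_assoc, ← mul_assoc _ (1 / (2 * π) : ℂ),
    mul_comm _ (1 / (2 * π) : ℂ), mul_assoc, ← integral_const_mul]
  congr 2
  refine integral_congr_ae (Eventually.of_forall fun y => ?_)
  simp only [neg_neg]
  ring

end Summit.KontsevichZagierPeriods.Zeta5Search.SorokinFirstVariable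

end
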